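import Literature.NumberTheory.EllipticCurves.ShintaniIndefiniteStabilizersB
import Literature.NumberTheory.EllipticCurves.AnnulusFundamentalDomain
import Literature.NumberTheory.EllipticCurves.ShintaniLiftUnfolded
import Literature.NumberTheory.EllipticCurves.ShintaniOrbitIntegrals
import Literature.NumberTheory.EllipticCurves.ShintaniFormEquivariance
import HarnessLib

/-!
# The orbit integral of an anisotropic indefinite vector: Shintani's cycle integral

[[cite: Shintani1975, §2, Prop. 2.3, (2.13)–(2.14) (p. 104)]] — for `x` indefinite anisotropic,
`∫_{Γ_x∖ℍ} φ(w) f_{w,Z}(x) dμ(w)` is computed by moving the roots of `x` to `0, ∞` (`x ∘ M = λXY`),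
where `Γ_x` acts by homotheties `u ↦ κ₀^m u` with fundamental domain the annulus
`1 ≤ |u| < κ₀`, and the transverse Gaussian integrates to `√(π/c)` (`ShintaniOrbitIntegrals`).
For the twisted level-64 lift (`orbitIntegral` of `ShintaniLiftUnfolded`) we PROVE:

* `shintaniFn_actSL` (transport under any `M ∈ SL₂(ℝ)`), `liftTerm_sl_smul` — on `M • u` the term
  is `(φ|M)(u) · c_D(k₀) λ e(λ²Z) · u · e^{-4π Im Z λ² (Re u/Im u)²}` with
  `slashSL φ M τ = φ(Mτ)(M₁₀τ + M₁₁)⁻²`;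
* `differentiableOn_slashSL`, `norm_slashSL_mul_im_le` (`‖φ|M‖ Im ≤ C₀`), `slashSL_mul_inv`
  (invariance under the generator: `(φ|M)(κ₀u)κ₀ = (φ|M)(u)`), `volume_norm_eq_one`
  (the unit semicircle is null), `setIntegral_sl_smul_set_real`;
* **`orbitIntegral_aniso`** — `J(ω) = c_D(k_ω) λ e(λ²Z) · (∫₁^{κ₀} (φ|M)(iy) i dy) · √(π/(4π Im Z λ²))`
  with `M, λ, κ₀` from `ShintaniIndefiniteStabilizersB.indef_stabilizer`.

No named facts; the definitions are `slashSL` and `anisoConst`.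
-/

noncomputable section

open scoped MatrixGroups ModularForm Modular Topology ENNReal Pointwise Manifold
open UpperHalfPlane hiding I
open Complex Filter MeasureTheory Set CongruenceSubgroup ModularGroup Real MulAction
open Literature.NumberTheory.EllipticCurves.ModularForms

namespace Literature.NumberTheory.EllipticCurves.Shintani

/-! ### `SL₂(ℝ)` acting on `ℍ`: coordinates, measure, transport of the kernel terms -/

-- `coe_sl_smul` (the coordinate of `M • w`) is `ShintaniFormEquivariance.coe_sl_smul`.

/-- The denominator of `M ∈ SL₂(ℝ)` does not vanish on `ℍ`. [folklore] -/
theorem sl_denom_ne_zero_real (M : SL(2, ℝ)) (w : ℍ) : ((M 1 0 : ℝ) : ℂ) * w + ((M 1 1 : ℝ) : ℂ) ≠ 0 := by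
  have := UpperHalfPlane.denom_ne_zero (M : GL (Fin 2) ℝ) w
  simpa [UpperHalfPlane.denom] using this

/-- `M • w = glOf (entries) • w`. [folklore] -/
theorem sl_smul_eq_glOf_smul (M : SL(2, ℝ)) (w : ℍ) :
    M • w = (glOf (M 0 0) (M 0 1) (M 1 0) (M 1 1) (det_entries_real M)) • w := by
  apply UpperHalfPlane.ext
  rw [coe_sl_smul, coe_glOf_smul]

/-- **Transport of the kernel term under `M ∈ SL₂(ℝ)`**: `f_{u,Z}(x ∘ M) = (c u + d)² f_{Mu,Z}(x)`. [folklore] -/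
theorem shintaniFn_actSL (M : SL(2, ℝ)) (u Z : ℍ) (x : V) :
    shintaniFn u Z (actSL M x) = (((M 1 0 : ℝ) : ℂ) * u + ((M 1 1 : ℝ) : ℂ)) ^ 2 * shintaniFn (M • u) Z x := by
  rw [actSL, shintaniFn_glOf (det_entries_real M), sl_smul_eq_glOf_smul]

/-- `Im (M w) = Im w / |c w + d|²`. [folklore] -/
theorem sl_smul_im (M : SL(2, ℝ)) (w : ℍ) :
    (M • w).im = w.im / Complex.normSq (((M 1 0 : ℝ) : ℂ) * w + ((M 1 1 : ℝ) : ℂ)) := by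
  have h := UpperHalfPlane.im_smul_eq_div_normSq (M : GL (Fin 2) ℝ) w
  rw [show ((M : GL (Fin 2) ℝ) • w) = M • w from rfl] at h
  rw [h]
  simp [UpperHalfPlane.denom]

/-- Translating a set integral by `M ∈ SL₂(ℝ)` (invariance of the hyperbolic measure). [folklore] -/
theorem setIntegral_sl_smul_set_real {E : Type*} [NormedAddCommGroup E] [NormedSpace ℝ E] (M : SL(2, ℝ))
    (ψ : ℍ → E) (S : Set ℍ) : ∫ x in M • S, ψ x = ∫ x in S, ψ (M • x) := by
  have hmp := measurePreserving_smul (M : GL (Fin 2) ℝ) (volume : Measure ℍ)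
  have hS : M • S = (fun x : ℍ ↦ (M : GL (Fin 2) ℝ) • x) '' S := by
    ext y; simp [Set.mem_smul_set]; rfl
  rw [hS, hmp.setIntegral_image_emb (MeasurableEquiv.smul (M : GL (Fin 2) ℝ)).measurableEmbedding ψ S]
  rfl

/-- Integrability transported along `M`. [folklore] -/
theorem integrableOn_sl_smul_set_real_iff {E : Type*} [NormedAddCommGroup E] (M : SL(2, ℝ)) (ψ : ℍ → E)
    (S : Set ℍ) : IntegrableOn ψ (M • S) ↔ IntegrableOn (fun x ↦ ψ (M • x)) S := by
  have hmp := measurePreserving_smul (M : GL (Fin 2) ℝ) (volume : Measure ℍ)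
  have hS : M • S = (fun x : ℍ ↦ (M : GL (Fin 2) ℝ) • x) '' S := by
    ext y; simp [Set.mem_smul_set]; rfl
  rw [hS]
  exact hmp.integrableOn_image (MeasurableEquiv.smul (M : GL (Fin 2) ℝ)).measurableEmbedding

/-! ### The unit semicircle is null; the two annuli agree a.e. -/

/-- The unit semicircle `{|τ| = 1}` has hyperbolic measure zero. [folklore] -/
theorem volume_norm_eq_one : volume {τ : ℍ | ‖(τ : ℂ)‖ = 1} = 0 := by
  have hmeas : MeasurableSet {τ : ℍ | ‖(τ : ℂ)‖ = 1} :=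
    (continuous_norm.comp UpperHalfPlane.continuous_coe).measurable (measurableSet_singleton 1)
  rw [UpperHalfPlane.volume_def]
  refine withDensity_absolutelyContinuous _ _ ?_
  rw [Measure.comap_apply _ UpperHalfPlane.coe_injective
    (fun s hs ↦ UpperHalfPlane.measurableEmbedding_coe.measurableSet_image.mpr hs) _ hmeas]
  refine measure_mono_null (fun z ⟨τ, hτ, hz⟩ ↦ ?_) (Measure.addHaar_sphere volume (0 : ℂ) 1)
  rw [Metric.mem_sphere, dist_zero_right, ← hz]
  exact hτ

/-- `{1 ≤ |τ| < κ₀} =ᵐ {1 < |τ| < κ₀}`. [folklore] -/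
theorem hannulus_ae_eq_Ioo (κ₀ : ℝ) :
    hannulus κ₀ =ᵐ[volume] {τ : ℍ | ‖(τ : ℂ)‖ ∈ Ioo 1 κ₀} := by
  rw [ae_eq_set]
  constructor
  · refine measure_mono_null (fun τ hτ ↦ ?_) volume_norm_eq_one
    obtain ⟨h1, h2⟩ := hτ
    have h1' : 1 ≤ ‖(τ : ℂ)‖ ∧ ‖(τ : ℂ)‖ < κ₀ := h1
    have h2' : ¬ (1 < ‖(τ : ℂ)‖ ∧ ‖(τ : ℂ)‖ < κ₀) := h2
    show ‖(τ : ℂ)‖ = 1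
    by_contra hne
    exact h2' ⟨lt_of_le_of_ne h1'.1 (Ne.symm hne), h1'.2⟩
  · refine measure_mono_null (fun τ hτ ↦ ?_) (measure_empty (μ := (volume : Measure ℍ)))
    obtain ⟨h1, h2⟩ := hτ
    have h1' : 1 < ‖(τ : ℂ)‖ ∧ ‖(τ : ℂ)‖ < κ₀ := h1
    have h2' : ¬ (1 ≤ ‖(τ : ℂ)‖ ∧ ‖(τ : ℂ)‖ < κ₀) := h2
    exact h2' ⟨h1'.1.le, h1'.2⟩

/-! ### The transported cusp form `ψ₁ = φ|M` and the term on `M • u` -/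

variable (D : ℕ) [NeZero D]

/-- The transported form `(φ|M)(τ) = φ(Mτ)(cτ + d)⁻²` (`M ∈ SL₂(ℝ)`), as a function on `ℂ`. [folklore] -/
def slashSL (f : ℍ → ℂ) (M : SL(2, ℝ)) (τ : ℂ) : ℂ :=
  f (M • UpperHalfPlane.ofComplex τ) * ((((M 1 0 : ℝ) : ℂ) * τ + ((M 1 1 : ℝ) : ℂ)) ^ 2)⁻¹

/-- The constant `K = c_D(k₀) λ e(λ² Z)`. [folklore] -/
def anisoConst (z : ℍ) (k₀ : Fin 3 → ℤ) (lam : ℝ) : ℂ :=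
  cD D k₀ * ((lam : ℂ) * cexp (2 * π * I * (lam ^ 2 : ℝ) * (zScaled D z : ℂ)))

variable {D}

/-- **The term on `M • u`** when `ι♮(k₀) ∘ M = λXY`:
`term(k₀)(Mu) = (φ|M)(u) K · u · e^{-4π Im Z λ² (Re u/Im u)²}`. [folklore] -/
theorem liftTerm_sl_smul (f : ℍ → ℂ) (z : ℍ) {k₀ : Fin 3 → ℤ} {M : SL(2, ℝ)} {lam : ℝ}
    (hM : actSL M (latSharp k₀) = xyForm lam) (u : ℍ) :
    liftTerm D f z k₀ (M • u) = (slashSL f M u * anisoConst D z k₀ lam) * (u : ℂ) *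
      (Real.exp (-(4 * π * (zScaled D z : ℂ).im * lam ^ 2) * ((u : ℂ).re / (u : ℂ).im) ^ 2) : ℂ) := by
  have hj := sl_denom_ne_zero_real M u
  have h1 := shintaniFn_actSL M u (zScaled D z) (latSharp k₀)
  rw [hM, shintaniFn_xyForm] at h1
  have h2 : shintaniFn (M • u) (zScaled D z) (latSharp k₀) =
      ((lam : ℂ) * cexp (2 * π * I * (lam ^ 2 : ℝ) * (zScaled D z : ℂ))) * (u : ℂ) *
        (Real.exp (-(4 * π * (zScaled D z : ℂ).im * lam ^ 2) * ((u : ℂ).re / (u : ℂ).im) ^ 2) : ℂ) /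
        (((M 1 0 : ℝ) : ℂ) * u + ((M 1 1 : ℝ) : ℂ)) ^ 2 := by
    rw [eq_div_iff (pow_ne_zero 2 hj), mul_comm, ← h1]
  rw [liftTerm, h2, slashSL, anisoConst, UpperHalfPlane.ofComplex_apply]
  field_simp

/-- `(φ|M) K` at `κ u` relates to `u`: the invariance under the generator of the stabiliser.
With `M⁻¹(γ₁ w) = κ₀ · M⁻¹ w` and `term(k₀)` `Γ_{k₀}`-invariant,
`(φ|M)(κ₀ u) κ₀ = (φ|M)(u)` (times `K`). [folklore] -/
theorem slashSL_mul_inv (hD : Odd D) (f : CuspForm (Gamma0 64) 2) (z : ℍ) {k₀ : Fin 3 → ℤ}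
    {M : SL(2, ℝ)} {lam κ₀ : ℝ} (hκ : 1 < κ₀) (hM : actSL M (latSharp k₀) = xyForm lam)
    {γ₁ : stabK k₀} (hγ₁ : ∀ w : ℍ, (((M⁻¹ • (((γ₁ : Gamma0Plus 64) : SL(2, ℤ)) • w) : ℍ)) : ℂ) =
      ((κ₀ : ℝ) : ℂ) * (((M⁻¹ • w : ℍ)) : ℂ)) {w : ℂ} (hw : 0 < w.im) :
    slashSL f M (((κ₀ / 1 : ℝ)) * w) * anisoConst D z k₀ lam * ((κ₀ / 1 : ℝ)) =
      slashSL f M w * anisoConst D z k₀ lam := by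
  have hκ0 : 0 < κ₀ := by linarith
  set u : ℍ := ⟨w, hw⟩ with hu
  set u' : ℍ := mulPos κ₀ hκ0 u with hu'
  -- `γ₁ • (M • u) = M • u'`
  have hpt : (((γ₁ : Gamma0Plus 64) : SL(2, ℤ))) • (M • u) = M • u' := by
    have h1 : M⁻¹ • ((((γ₁ : Gamma0Plus 64) : SL(2, ℤ))) • (M • u)) = u' := by
      apply UpperHalfPlane.ext
      rw [hγ₁ (M • u), inv_smul_smul, hu', coe_mulPos]
    calc (((γ₁ : Gamma0Plus 64) : SL(2, ℤ))) • (M • u)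
        = M • (M⁻¹ • ((((γ₁ : Gamma0Plus 64) : SL(2, ℤ))) • (M • u))) := by rw [smul_inv_smul]
      _ = M • u' := by rw [h1]
  have hinv := liftTerm_stab_invariant D hD f z k₀ γ₁ (M • u)
  have hinv' : liftTerm D f z k₀ (M • u') = liftTerm D f z k₀ (M • u) := by
    rw [← hpt]; exact hinv
  rw [liftTerm_sl_smul f z hM, liftTerm_sl_smul f z hM] at hinv'
  -- the Gaussian factors agree (`Re/Im` is scale invariant) and `u' = κ₀ u`
  have hratio : ((u' : ℂ).re / (u' : ℂ).im) = ((u : ℂ).re / (u : ℂ).im) := by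
    rw [hu', mulPos_re, mulPos_im, mul_div_mul_left _ _ hκ0.ne']
  rw [hratio] at hinv'
  have hu'c : ((u' : ℍ) : ℂ) = ((κ₀ : ℝ) : ℂ) * (u : ℂ) := by rw [hu', coe_mulPos]
  rw [hu'c] at hinv'
  have hG : (Real.exp (-(4 * π * (zScaled D z : ℂ).im * lam ^ 2) * ((u : ℂ).re / (u : ℂ).im) ^ 2) : ℂ) ≠ 0 :=
    Complex.ofReal_ne_zero.mpr (Real.exp_pos _).ne'
  have hu0 : (u : ℂ) ≠ 0 := UpperHalfPlane.ne_zero u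
  have huw : (u : ℂ) = w := rfl
  rw [div_one, huw] at *
  -- cancel `u · G`
  have := mul_right_cancel₀ hG hinv'
  have h3 : slashSL f M (((κ₀ : ℝ) : ℂ) * w) * anisoConst D z k₀ lam * ((κ₀ : ℝ) : ℂ) * w =
      slashSL f M w * anisoConst D z k₀ lam * w := by
    calc slashSL f M (((κ₀ : ℝ) : ℂ) * w) * anisoConst D z k₀ lam * ((κ₀ : ℝ) : ℂ) * w
        = slashSL f M (((κ₀ : ℝ) : ℂ) * w) * anisoConst D z k₀ lam * (((κ₀ : ℝ) : ℂ) * w) := by ring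
      _ = slashSL f M w * anisoConst D z k₀ lam * w := this
  exact mul_right_cancel₀ (by rw [← huw]; exact hu0) h3

/-! ### Holomorphy and the invariant bound of `φ|M` -/

/-- The Möbius map of `M ∈ SL₂(ℝ)` preserves `Im > 0`. [folklore] -/
theorem moeb_im_pos (M : SL(2, ℝ)) {τ : ℂ} (hτ : 0 < τ.im) :
    0 < ((((M 0 0 : ℝ) : ℂ) * τ + ((M 0 1 : ℝ) : ℂ)) / (((M 1 0 : ℝ) : ℂ) * τ + ((M 1 1 : ℝ) : ℂ))).im := by
  have h := (M • (⟨τ, hτ⟩ : ℍ)).im_pos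
  rw [← UpperHalfPlane.coe_im, coe_sl_smul] at h
  exact h

/-- `M • ofComplex τ = ofComplex (Möbius τ)` for `Im τ > 0`. [folklore] -/
theorem sl_smul_ofComplex (M : SL(2, ℝ)) {τ : ℂ} (hτ : 0 < τ.im) :
    M • UpperHalfPlane.ofComplex τ = UpperHalfPlane.ofComplex
      ((((M 0 0 : ℝ) : ℂ) * τ + ((M 0 1 : ℝ) : ℂ)) / (((M 1 0 : ℝ) : ℂ) * τ + ((M 1 1 : ℝ) : ℂ))) := by
  apply UpperHalfPlane.ext
  rw [coe_sl_smul, UpperHalfPlane.ofComplex_apply_of_im_pos hτ,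
    UpperHalfPlane.ofComplex_apply_of_im_pos (moeb_im_pos M hτ)]

/-- The denominator does not vanish on `Im > 0`. [folklore] -/
theorem moeb_denom_ne_zero' (M : SL(2, ℝ)) {τ : ℂ} (hτ : 0 < τ.im) :
    ((M 1 0 : ℝ) : ℂ) * τ + ((M 1 1 : ℝ) : ℂ) ≠ 0 := by
  have := sl_denom_ne_zero_real M ⟨τ, hτ⟩
  exact this

/-- **`φ|M` is holomorphic on `Im > 0`** for a cusp form `φ`. [folklore] -/
theorem differentiableOn_slashSL (f : CuspForm (Gamma0 64) 2) (M : SL(2, ℝ)) :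
    DifferentiableOn ℂ (slashSL f M) {τ : ℂ | 0 < τ.im} := by
  have hf : DifferentiableOn ℂ (⇑f ∘ UpperHalfPlane.ofComplex) {τ : ℂ | 0 < τ.im} :=
    UpperHalfPlane.mdifferentiable_iff.mp (CuspFormClass.holo f)
  set moeb : ℂ → ℂ := fun τ ↦ (((M 0 0 : ℝ) : ℂ) * τ + ((M 0 1 : ℝ) : ℂ)) / (((M 1 0 : ℝ) : ℂ) * τ + ((M 1 1 : ℝ) : ℂ))
    with hmoeb
  have hm : DifferentiableOn ℂ moeb {τ : ℂ | 0 < τ.im} := by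
    intro τ hτ
    refine DifferentiableAt.differentiableWithinAt ?_
    exact ((differentiableAt_const _).mul differentiableAt_id |>.add (differentiableAt_const _)).div
      ((differentiableAt_const _).mul differentiableAt_id |>.add (differentiableAt_const _)) (moeb_denom_ne_zero' M hτ)
  have hmaps : MapsTo moeb {τ : ℂ | 0 < τ.im} {τ : ℂ | 0 < τ.im} := fun τ hτ ↦ moeb_im_pos M hτ
  have hcomp := hf.comp hm hmaps
  have hden : DifferentiableOn ℂ (fun τ : ℂ ↦ ((((M 1 0 : ℝ) : ℂ) * τ + ((M 1 1 : ℝ) : ℂ)) ^ 2)⁻¹) {τ : ℂ | 0 < τ.im} := by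
    intro τ hτ
    refine DifferentiableAt.differentiableWithinAt ?_
    refine (((differentiableAt_const _).mul differentiableAt_id |>.add (differentiableAt_const _)).pow 2).inv ?_
    exact pow_ne_zero 2 (moeb_denom_ne_zero' M hτ)
  refine (hcomp.mul hden).congr fun τ hτ ↦ ?_
  simp only [slashSL, Pi.mul_apply, Function.comp_apply, hmoeb]
  rw [sl_smul_ofComplex M hτ]

/-- **The invariant bound**: `‖(φ|M)(w)‖ Im w ≤ C₀` where `‖φ(τ)‖ Im τ ≤ C₀`. [folklore] -/
theorem norm_slashSL_mul_im_le (f : CuspForm (Gamma0 64) 2) (M : SL(2, ℝ)) {C₀ : ℝ}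
    (hC₀ : ∀ τ : ℍ, ‖f τ‖ * τ.im ≤ C₀) {w : ℂ} (hw : 0 < w.im) :
    ‖slashSL f M w‖ * w.im ≤ C₀ := by
  set u : ℍ := ⟨w, hw⟩
  have hu : UpperHalfPlane.ofComplex w = u := by
    apply UpperHalfPlane.ext; rw [UpperHalfPlane.ofComplex_apply_of_im_pos hw]
  have hj := sl_denom_ne_zero_real M u
  have him := sl_smul_im M u
  have hns : Complex.normSq (((M 1 0 : ℝ) : ℂ) * u + ((M 1 1 : ℝ) : ℂ)) =
      ‖((M 1 0 : ℝ) : ℂ) * u + ((M 1 1 : ℝ) : ℂ)‖ ^ 2 := Complex.normSq_eq_norm_sq _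
  have h := hC₀ (M • u)
  rw [him, hns] at h
  rw [slashSL, hu, norm_mul, norm_inv, norm_pow]
  have huw : (u : ℂ) = w := rfl
  have hwim : w.im = u.im := rfl
  rw [huw] at *
  rw [hwim]
  have hpos : 0 < ‖((M 1 0 : ℝ) : ℂ) * w + ((M 1 1 : ℝ) : ℂ)‖ ^ 2 := by positivity
  calc ‖f (M • u)‖ * (‖((M 1 0 : ℝ) : ℂ) * w + ((M 1 1 : ℝ) : ℂ)‖ ^ 2)⁻¹ * u.im
      = ‖f (M • u)‖ * (u.im / ‖((M 1 0 : ℝ) : ℂ) * w + ((M 1 1 : ℝ) : ℂ)‖ ^ 2) := by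
        field_simp
    _ ≤ C₀ := h

/-- Pulling a constant out of a ray integral. [folklore] -/
theorem rayIntegral_mul_const (ψ : ℂ → ℂ) (K : ℂ) (θ r₁ r₂ : ℝ) :
    rayIntegral (fun τ ↦ ψ τ * K) θ r₁ r₂ = K * rayIntegral ψ θ r₁ r₂ := by
  unfold rayIntegral
  rw [← intervalIntegral.integral_const_mul]
  refine intervalIntegral.integral_congr fun r _ ↦ ?_
  simp only; ring

/-! ### The anisotropic orbit integral -/

variable (D)

/-- **The orbit integral of an anisotropic indefinite vector** (`D` odd, `φ ∈ S₂(Γ₀(64))`): for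
`ω` with `Δ(k_ω) > 0` not a square there are `M ∈ SL₂(ℝ)` with `ι♮(k_ω) ∘ M = λ XY`, and the
multiplier `κ₀ > 1` of a generator of `Γ_{k_ω}`, such that
`J(ω) = c_D(k_ω) λ e(λ² Z) · (∫₁^{κ₀} (φ|M)(iy) i dy) · √(π/(4π Im Z λ²))` — Shintani's evaluation
(2.13)–(2.14) of the orbit integral as a CYCLE INTEGRAL of `φ` over the closed geodesic of the form
(the transverse Gaussian integrates to `√(π/c)`, `ShintaniOrbitIntegrals`).
[cite: Shintani1975, §2, Prop. 2.3, (2.13)–(2.14)] -/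
theorem orbitIntegral_aniso (hD : Odd D) (f : CuspForm (Gamma0 64) 2) (z : ℍ)
    (ω : orbitRel.Quotient (Gamma0Plus 64) (Fin 3 → ℤ)) (hpos : 0 < intDisc ω.out)
    (hnsq : ¬ IsSquare (intDisc ω.out)) :
    ∃ (M : SL(2, ℝ)) (lam κ₀ : ℝ), lam ≠ 0 ∧ 1 < κ₀ ∧ actSL M (latSharp ω.out) = xyForm lam ∧
      orbitIntegral D f z ω = anisoConst D z ω.out lam *
        rayIntegral (slashSL f M) (π / 2) 1 κ₀ *
          (Real.sqrt (π / (4 * π * (zScaled D z : ℂ).im * lam ^ 2)) : ℝ) := by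
  set k₀ := ω.out with hk₀
  obtain ⟨M, lam, κ₀, m, hlam, hκ, hM, hm, hact⟩ := indef_stabilizer k₀ hpos hnsq
  refine ⟨M, lam, κ₀, hlam, hκ, hM, ?_⟩
  have hκ0 : 0 < κ₀ := by linarith
  -- the two fundamental domains of `Γ_{k₀}`
  have hFD := isFundamentalDomain_orbitDomain k₀
  have hFD' : IsFundamentalDomain (stabK k₀) (M • hannulus κ₀) (volume : Measure ℍ) :=
    isFundamentalDomain_conj_hannulus M hκ m hm (fun γ w ↦ hact γ w)
  have hinv : ∀ (γ : stabK k₀) (w : ℍ), liftTerm D f z k₀ (γ • w) = liftTerm D f z k₀ w :=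
    liftTerm_stab_invariant D hD f z k₀
  unfold orbitIntegral
  rw [← hk₀, hFD.setIntegral_eq hFD' hinv, setIntegral_sl_smul_set_real,
    setIntegral_congr_set (hannulus_ae_eq_Ioo κ₀)]
  simp_rw [liftTerm_sl_smul f z hM]
  -- the sibling's evaluation
  obtain ⟨C₀, -, hC₀⟩ := exists_norm_mul_im_le f
  obtain ⟨γ₁, hγ₁⟩ := hm.2 1
  have hgen : ∀ w : ℍ, (((M⁻¹ • (((γ₁ : Gamma0Plus 64) : SL(2, ℤ)) • w) : ℍ)) : ℂ) =
      ((κ₀ : ℝ) : ℂ) * (((M⁻¹ • w : ℍ)) : ℂ) := by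
    intro w; rw [hact γ₁ w, hγ₁, zpow_one]
  have hc : 0 < 4 * π * (zScaled D z : ℂ).im * lam ^ 2 := by
    have h1 : 0 < (zScaled D z : ℂ).im := by rw [UpperHalfPlane.coe_im]; exact (zScaled D z).im_pos
    have h2 : 0 < lam ^ 2 := by positivity
    positivity
  have hCψ : ∀ w : ℂ, 0 < w.im → ‖slashSL f M w * anisoConst D z k₀ lam‖ * w.im ≤ C₀ * ‖anisoConst D z k₀ lam‖ := by
    intro w hw
    calc ‖slashSL f M w * anisoConst D z k₀ lam‖ * w.im
        = (‖slashSL f M w‖ * w.im) * ‖anisoConst D z k₀ lam‖ := by rw [norm_mul]; ring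
      _ ≤ C₀ * ‖anisoConst D z k₀ lam‖ :=
        mul_le_mul_of_nonneg_right (norm_slashSL_mul_im_le f M hC₀ hw) (norm_nonneg _)
  have key := setIntegral_upperHalfPlane_annulus_eq (ψ := fun τ ↦ slashSL f M τ * anisoConst D z k₀ lam)
    (c := 4 * π * (zScaled D z : ℂ).im * lam ^ 2) (C := C₀ * ‖anisoConst D z k₀ lam‖) (r₁ := 1) (r₂ := κ₀)
    ((differentiableOn_slashSL f M).mul_const _) hCψ hc one_pos hκ.le
    (fun w hw ↦ slashSL_mul_inv hD f z hκ hM hgen hw)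
  rw [rayIntegral_mul_const] at key
  rw [← key]

end Literature.NumberTheory.EllipticCurves.Shintani
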